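import Literature.MathematicalPhysics.QuantumFieldTheory.Balaban1983to89.B10NodeKnit

/-!
# `Balaban1983to89.B10CompactBinding` — the Q2-(C) CANDIDATE binding, DEFINED FOR THE RECORD AND BOUND NOWHERE (seat dag-n08-a):
# the one-leaf re-binder `withB10`, the N-binding with the [Balaban1985UV3] leaf in the COMPACT reading `ofPrintedAllXPNC`
# (both in THIS module's namespace — no `DagBinding.*` declaration is added or touched), and node N08 at it

YM-PLAN §9 Q2 (OPEN; asked of the chair, pub-ymgap INBOX l.8932) is whether node N08's own leaf is read LITERALLY
(`B10.Thm1Printed X.runs10 ∧ B10.Thm2Printed X.runs10`, refuted on fine-lattice leaf-system families, `B10DagLeaf`) or COMPACTLY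
(`DagDischarged.b10Compact X = B10.Thm1PrintedCompact X.runs10 ∧ B10.Thm2Printed X.runs10`: Theorem 1 p. 257 with «the constant O(1) is
independent of ε, k, g_k in a bounded set» read as one constant per compact coupling window, cell GAPS G-B10-01 — proved from leaf systems,
`B10Assembly`).  IF (C) is ruled, the binding act is this file's content: `withB10` (Prop-generic plumbing, the pattern of
`DagDischargedII.Upstream.withB4` :815 ∕ `DagBinding.Upstream.withB6` :1672), `ofPrintedAllXPNC X Y Z V W := withB10 (ofPrintedAllXPN X Y Z V W)
(b10Compact X.toPrintedCarriers)` (the pattern of `ofPrintedAllXPN` :866), the `rfl` leaf table, the transfer «literal ⇒ compact» for families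
with bounded couplings (so nothing proved at the N-binding is lost), and N08 BY NAME at a world bound by it over leaf-system tower-run
carriers (`B10NodeKnit.b10_main_of_upCompact` with the named binding).  Like `DagDischarged.b10Compact` («DEFINED here for the record, bound
nowhere») this module BINDS NOTHING OF RECORD: `ofPrintedAllXPN` and every `Node00.IsWorldOfRecordₛ` are untouched; whether a NODE 00
B10-pin stage imports `ofPrintedAllXPNC` is the chair's Q2 word and node00-def's act.  Both new declarations live in THIS namespace
(`B10CompactBinding.withB10`, `B10CompactBinding.ofPrintedAllXPNC`) — nothing is declared inside `DagBinding`.  HONEST FRAMING: two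
definitions + `rfl` bookkeeping; nothing of [Balaban1985UV3] asserted; nothing continuum ∕ ℝ⁴ ∕ OS ∕ mass gap ∕ Clay.
-/

noncomputable section

namespace Literature.MathematicalPhysics.QuantumFieldTheory.Balaban1983to89.B10CompactBinding

open DagBinding DagDischargedII Node00
open B10 (TowerRun Thm1Printed Thm2Printed Thm1PrintedCompact)
open B10Assembly (LeafSystem)
open DagDischarged (b10Compact)

/-! ## §1. Plumbing: re-binding the `b10` slot -/

/-- Re-binding ONE leaf: the upstream `u` with its `b10` slot replaced by the proposition `b10` (all other leaves unchanged, `rfl`).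
Prop-generic plumbing. [cite: Balaban1985UV3, Thm 1 p.257 (the slot re-bound; bookkeeping)] -/
def withB10 (u : Upstream) (b10 : Prop) : Upstream :=
  { u with b10 := b10 }

/-- Bookkeeping (`rfl`): the re-bound leaf and the untouched ones. [cite: Balaban1985UV3, Thm 1 p.257 (bookkeeping)] -/
theorem withB10_leaves (u : Upstream) (b10 : Prop) :
    (withB10 u b10).b10 = b10 ∧ (withB10 u b10).b4 = u.b4 ∧ (withB10 u b10).b5 = u.b5 ∧ (withB10 u b10).b6 = u.b6 ∧
    (withB10 u b10).b7 = u.b7 ∧ (withB10 u b10).b8 = u.b8 ∧ (withB10 u b10).b9 = u.b9 ∧ (withB10 u b10).b11 = u.b11 ∧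
    (withB10 u b10).b12 = u.b12 ∧ (withB10 u b10).b13 = u.b13 ∧ (withB10 u b10).rOperation = u.rOperation ∧
    (withB10 u b10).rBasicStep = u.rBasicStep :=
  ⟨rfl, rfl, rfl, rfl, rfl, rfl, rfl, rfl, rfl, rfl, rfl, rfl⟩

/-! ## §2. The N-binding with the B10 leaf in the COMPACT reading -/

variable (X : PrintedCarriersR) (Y : PrintedCarriers9X) (Z : PrintedCarriers11) (V : PrintedCarriers14R) (W : PrintedCarriers15)

/-- **The parameter-free binding with the B10 leaf in the COMPACT reading** (b4 in NN form, b6 in parameter form as in `ofPrintedAllXPN`):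
`b10 := DagDischarged.b10Compact X = B10.Thm1PrintedCompact X.runs10 ∧ B10.Thm2Printed X.runs10`. [cite: Balaban1985UV3, Thm 1 p.257 (compact reading, cell GAPS G-B10-01) + Thm 2 p.272] -/
def ofPrintedAllXPNC : Upstream :=
  withB10 (Upstream.ofPrintedAllXPN X Y Z V W) (b10Compact X.toPrintedCarriers)

/-- The C-binding IS the N-binding with the one slot `b10` updated (`rfl`) — the shape `B10NodeKnit.b10_main_of_upCompact` consumes. [cite: Balaban1985UV3, Thm 1 p.257 (bookkeeping)] -/
theorem ofPrintedAllXPNC_eq_update :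
    ofPrintedAllXPNC X Y Z V W =
      { Upstream.ofPrintedAllXPN X Y Z V W with b10 := b10Compact X.toPrintedCarriers } :=
  rfl

/-- Bookkeeping (`rfl`): the leaves of the C-binding — `b10` is the compact node, every other leaf is the N-binding's. [cite: Balaban1985UV3, Thm 1 p.257 (bookkeeping)] -/
theorem ofPrintedAllXPNC_leaves :
    (ofPrintedAllXPNC X Y Z V W).b10 = b10Compact X.toPrintedCarriers ∧
    (ofPrintedAllXPNC X Y Z V W).b4 = (Upstream.ofPrintedAllXPN X Y Z V W).b4 ∧
    (ofPrintedAllXPNC X Y Z V W).b5 = (Upstream.ofPrintedAllXPN X Y Z V W).b5 ∧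
    (ofPrintedAllXPNC X Y Z V W).b6 = (Upstream.ofPrintedAllXPN X Y Z V W).b6 ∧
    (ofPrintedAllXPNC X Y Z V W).b7 = (Upstream.ofPrintedAllXPN X Y Z V W).b7 ∧
    (ofPrintedAllXPNC X Y Z V W).b8 = (Upstream.ofPrintedAllXPN X Y Z V W).b8 ∧
    (ofPrintedAllXPNC X Y Z V W).b9 = (Upstream.ofPrintedAllXPN X Y Z V W).b9 ∧
    (ofPrintedAllXPNC X Y Z V W).b11 = (Upstream.ofPrintedAllXPN X Y Z V W).b11 ∧
    (ofPrintedAllXPNC X Y Z V W).b12 = (Upstream.ofPrintedAllXPN X Y Z V W).b12 ∧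
    (ofPrintedAllXPNC X Y Z V W).b13 = (Upstream.ofPrintedAllXPN X Y Z V W).b13 ∧
    (ofPrintedAllXPNC X Y Z V W).rOperation = (Upstream.ofPrintedAllXPN X Y Z V W).rOperation ∧
    (ofPrintedAllXPNC X Y Z V W).rBasicStep = (Upstream.ofPrintedAllXPN X Y Z V W).rBasicStep :=
  ⟨rfl, rfl, rfl, rfl, rfl, rfl, rfl, rfl, rfl, rfl, rfl, rfl⟩

/-- The `b10` leaf of the C-binding unfolded (`Iff.rfl`). [cite: Balaban1985UV3, Thm 1 p.257 (compact reading) + Thm 2 p.272] -/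
theorem ofPrintedAllXPNC_b10_iff :
    (ofPrintedAllXPNC X Y Z V W).b10 ↔ Thm1PrintedCompact X.runs10 ∧ Thm2Printed X.runs10 := Iff.rfl

/-- **LITERAL ⇒ COMPACT at the binding**: for a run family with couplings positive and bounded above by `gtop` (in the paper
`g_k ≤ gε₀^{1/2}`), the N-binding's `b10` leaf implies the C-binding's (`DagDischarged.b10Compact_of_b10`) — nothing proved at the
N-binding is lost; never conversely (`B10DagLeaf.logRun_separation`). [cite: Balaban1985UV3, Thm 1 p.257 (both readings)] -/
theorem ofPrintedAllXPNC_b10_of_ofPrintedAllXPN (gtop : ℝ) (htop : 0 < gtop)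
    (hg : ∀ i k, k ≤ (X.runs10 i).K → 0 < (X.runs10 i).g k ∧ (X.runs10 i).g k ≤ gtop)
    (h : (Upstream.ofPrintedAllXPN X Y Z V W).b10) : (ofPrintedAllXPNC X Y Z V W).b10 :=
  DagDischarged.b10Compact_of_b10 X Y Z V W gtop htop hg h

/-! ## §3. Node N08 at a world bound by the C-binding over leaf-system tower-run carriers -/

variable {X Y Z V W} {I : Type} {C : B10Assembly.Consts} {T : I → TowerRun} (S : ∀ i, LeafSystem C (T i))
  {w : WorldP} {P : B12.RunParams}

include S in
/-- **N08 BY NAME at the C-binding**: if `w.up P = ofPrintedAllXPNC (X.withTowerRuns10 T) Y Z V W` for tower runs carrying leaf systems with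
common constants, `Dag.B10_main (leavesP w P)` holds (in-edges unused) — `B10NodeKnit.b10_main_of_upCompact` with the named binding. [cite: Balaban1985UV3, Thm 1 p.257 (compact reading) + Thm 2 p.272] -/
theorem b10_main_of_upC (hup : w.up P = ofPrintedAllXPNC (X.withTowerRuns10 T) Y Z V W) :
    Dag.B10_main (leavesP w P) :=
  B10NodeKnit.b10_main_of_upCompact S (hup.trans (ofPrintedAllXPNC_eq_update _ Y Z V W))

/-- The other carrier-pinned nodes are UNCHANGED at the C-binding (their leaves are the N-binding's, `rfl`): e.g. N04 over the Stage-2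
carriers of record. [cite: Balaban1985Averaging, Props. 1–10 pp.26–50 (bookkeeping: the re-binding touches b10 only)] -/
theorem b7_main_of_upC (θ : Stage2Params) (hup : w.up P = ofPrintedAllXPNC (carriers₂ θ X) Y Z V W) :
    Dag.B7_main (leavesP w P) := by
  intro _
  show (w.up P).b7
  rw [hup]
  exact carriers₂_b7 θ X Y Z V W

end Literature.MathematicalPhysics.QuantumFieldTheory.Balaban1983to89.B10CompactBinding

end
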